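import Summits.QuantumFields.YangMills.Theorems.PoincareLipschitzWenteOneCentreLetters
import Summits.QuantumFields.YangMills.Theorems.PoincareLipschitzWeakJacobianIdentity
import HarnessLib

/-!
# Crux `BlockLipschitzL` (stmt-QuantumFields-23533) ∕ `HistoryTailL` (stmt-QuantumFields-19936), LINE 25 «CompactnessTransfer»,
# stub S1″ — ROAD (W) «the H-system gap at 3π», brick W-ONE «WENTE ONE-CENTRE LEMMA», file 2: THE ANNULAR IDENTITY

Cell `ym3-torus` (YM ladder rung R3 = continuum SU(2) Yang–Mills on T³ — a RUNG, NOT Clay: not d = 4, not infinite volume,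
not a mass gap); TWIN-WIDTH helper seat `ym-ust-19936-w7` g15; `--supports stmt-QuantumFields-23533`; THEOREMS ONLY (0 `def`,
0 `sorry`, default heartbeats); imports file 1 (radial letters) and px19 g8's ✓`PoincareLipschitzWeakJacobianIdentity`
(★★★`integral_mul_jacobian`, the weak Jacobian identity `curl(a∇b) = ∇a ∧ ∇b` for `W^{1,2}_loc`).

THE SETTING (ROAD (W), memo `ROAD-W-WENTE-3PI-w3g16.md` §2, one component of the H-system).  `u a b : E² → ℝ` with weak
gradients `Gu Ga Gb` on the whole plane (lit `HasWeakFDerivOn` on `univ`), `a b ∈ L²_loc`, `Ga Gb ∈ L²_loc`, and the weak equation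
`−Δu = 2 det(∇a, ∇b)` in the once-integrated form `−∫ Σ_k ∂_kη · Gu e_k = 2 ∫ η (Ga e₀ Gb e₁ − Ga e₁ Gb e₀)` for all test functions `η`.

WHAT THIS FILE PROVES (`s = ‖y − x₀‖²`, `perp w = (−w₁, w₀)`):
* ★★ `integral_radialWeight_mul_eq` — THE MASTER IDENTITY: for every smooth profile `g` vanishing on `[S, ∞)`,
  `∫ (s·g′(s) + g(s))·u(y) dy = −∫ g(s)·a(y)·Gb y (perp (y − x₀)) dy`.
  (Test `Gu` with the radial field `g(s)(y − x₀)` [file 1], test the equation with `η = Γ(s)`, `Γ′ = g∕2` (so `∇η` is that field),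
  and rewrite `∫ η det(Ga,Gb)` by px19's weak Jacobian identity: `∫ η det = −∫ g(s) a Gb[perp(y − x₀)]`.  NO polar coordinates,
  NO second derivatives, nothing a.e. in the radius.)
* ★★ `integral_deriv_mul_eq` — the same with the weight written as `(s·g(s))′`.
* §3 the ANNULAR KERNELS `h_r(s) = ST((4s∕r² − 1)∕3)` (`ST` = Mathlib's `Real.smoothTransition`): smooth, `= 0` on `s ≤ r²∕4`, `= 1` on
  `s ≥ r²`, values in `[0,1]`; `h_r′(s) = r⁻²Ψ(s∕r²)` with `Ψ(t) = (4∕3)·ST′((4t − 1)∕3)`; and ★★★ `annularAverage_sub_eq` — for ALL radii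
  `r₀, r₁ > 0`: `𝒜_{r₀} u x₀ − 𝒜_{r₁} u x₀ = −π⁻¹ ∫ ((h_{r₀} − h_{r₁})(s)∕s)·a·Gb[perp(y − x₀)] dy`, where the SMOOTH ANNULAR AVERAGE is
  spelled out as `𝒜_r u x₀ = (π r²)⁻¹ ∫ Ψ(‖y − x₀‖²∕r²) u(y) dy` (kernel supported in `r∕2 ≤ ‖y − x₀‖ ≤ r`).
HONEST SCOPE.  Identities only (the BOUND `|…| ≤ π⁻¹‖Ga‖_{L²(A)}‖Gb‖_{L²(A)}` is file 3); nothing of (W-OSC), (GAP), (TM), S1″, K1,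
`MeanDeviationL`, `BlockLipschitzL`, `HistoryTailL` is proved here.  YM₃ on T³ is rung R3, not Clay; YM gap NOT proved; no summit
statement is proved here.

References: H. Wente (1969); H. Brezis, J.-M. Coron [BrezisCoron1985] (Lemma A.1); F. Hélein [Helein2002] (§3.1); P. Topping
[Topping1997].
-/

set_option autoImplicit false

noncomputable section

open MeasureTheory Set Function Filter Topology Metric TopologicalSpace
open scoped ContDiff BigOperators RealInnerProductSpace

namespace Summit.QuantumFields.YangMills.Theorems.PoincareLipschitzWenteOneCentreIdentity

open Literature.Analysis.FunctionSpaces (HasWeakFDerivOn IsTestFunctionOn)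
open Literature.Analysis.FluidPDE (perp)
open Summit.QuantumFields.YangMills.Theorems.PoincareLipschitzWenteOneCentreLetters
open Summit.QuantumFields.YangMills.Theorems.PoincareLipschitzWeakJacobianIdentity (integral_mul_jacobian)

/-! ## §1 The master identity -/

section Master

variable (x₀ : EuclideanSpace ℝ (Fin 2)) {u a b : EuclideanSpace ℝ (Fin 2) → ℝ}
  {Gu Ga Gb : EuclideanSpace ℝ (Fin 2) → EuclideanSpace ℝ (Fin 2) →L[ℝ] ℝ}

/-- ★★ **THE MASTER IDENTITY of the one-centre lemma.**  Let `u, a, b` have weak gradients `Gu, Ga, Gb` on the plane, `a, b, Ga, Gb`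
locally square-integrable, and let `−∫ Σ_k ∂_kη·Gu e_k = 2∫ η (Ga e₀ Gb e₁ − Ga e₁ Gb e₀)` for every test function `η` (the weak
form of `−Δu = 2 det(∇a, ∇b)`).  Then for every smooth `g` vanishing on `[S, ∞)`, with `s = ‖y − x₀‖²`:
`∫ (s g′(s) + g(s)) u(y) dy = −∫ g(s) a(y) Gb y (perp (y − x₀)) dy`.
[cite: Helein2002, §3.1 (Wente's lemma: `{a,b} = ∂_x(a∂_y b) − ∂_y(a∂_x b)` in `𝒟′`, polar form); BrezisCoron1985, Appendix Lemma A.1 (first step)] -/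
theorem integral_radialWeight_mul_eq
    (hu : HasWeakFDerivOn (⟨univ, isOpen_univ⟩ : Opens (EuclideanSpace ℝ (Fin 2))) volume u Gu)
    (ha : HasWeakFDerivOn (⟨univ, isOpen_univ⟩ : Opens (EuclideanSpace ℝ (Fin 2))) volume a Ga)
    (hb : HasWeakFDerivOn (⟨univ, isOpen_univ⟩ : Opens (EuclideanSpace ℝ (Fin 2))) volume b Gb)
    (ha2 : LocallyIntegrable (fun y => a y ^ 2) volume) (hb2 : LocallyIntegrable (fun y => b y ^ 2) volume)
    (hGa2 : LocallyIntegrable (fun y => ‖Ga y‖ ^ 2) volume) (hGb2 : LocallyIntegrable (fun y => ‖Gb y‖ ^ 2) volume)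
    (hEq : ∀ η : EuclideanSpace ℝ (Fin 2) → ℝ, ContDiff ℝ ∞ η → HasCompactSupport η →
      -(∫ y, ∑ k : Fin 2, fderiv ℝ η y (EuclideanSpace.single k (1:ℝ)) * Gu y (EuclideanSpace.single k (1:ℝ))) =
        2 * ∫ y, η y * (Ga y (EuclideanSpace.single 0 (1:ℝ)) * Gb y (EuclideanSpace.single 1 (1:ℝ)) -
          Ga y (EuclideanSpace.single 1 (1:ℝ)) * Gb y (EuclideanSpace.single 0 (1:ℝ))))
    {g : ℝ → ℝ} (hg : ContDiff ℝ ∞ g) {S : ℝ} (hgS : ∀ s, S ≤ s → g s = 0) :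
    ∫ y, (‖y - x₀‖ ^ 2 * deriv g (‖y - x₀‖ ^ 2) + g (‖y - x₀‖ ^ 2)) * u y =
      -∫ y, g (‖y - x₀‖ ^ 2) * a y * Gb y (perp (y - x₀)) := by
  -- (A) the radial field against `Gu`
  have hA := integral_div_radial_mul_eq x₀ hu hg hgS
  -- (B) the equation against the radial test function `η`
  have hη := isTestFunctionOn_radialTest x₀ hg hgS
  have hB := hEq _ hη.contDiff hη.hasCompactSupport
  have hBL : (fun y => ∑ k : Fin 2, fderiv ℝ (fun y : EuclideanSpace ℝ (Fin 2) => (1/2 : ℝ) * ∫ t in S..(‖y - x₀‖ ^ 2), g t) y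
      (EuclideanSpace.single k (1:ℝ)) * Gu y (EuclideanSpace.single k (1:ℝ))) = fun y => g (‖y - x₀‖ ^ 2) * Gu y (y - x₀) := by
    funext y
    simp_rw [fderiv_radialTest_apply_single x₀ hg hgS y]
    rw [← sum_coord_mul_apply_single (Gu y) (y - x₀), Finset.mul_sum]
    exact Finset.sum_congr rfl fun k _ => by ring
  rw [hBL] at hB
  -- (C) px19's weak Jacobian identity with the radial test function
  have hJ := integral_mul_jacobian (Ω := (⟨univ, isOpen_univ⟩ : Opens (EuclideanSpace ℝ (Fin 2)))) (μ := volume) ha hb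
    ((locallyIntegrableOn_univ).2 ha2) ((locallyIntegrableOn_univ).2 hb2)
    ((locallyIntegrableOn_univ).2 hGa2) ((locallyIntegrableOn_univ).2 hGb2) hη
    (EuclideanSpace.single 0 (1:ℝ)) (EuclideanSpace.single 1 (1:ℝ))
  simp only [Opens.coe_mk, Measure.restrict_univ] at hJ
  have hJL : (fun y => a y * (Gb y (EuclideanSpace.single 1 (1:ℝ)) *
      fderiv ℝ (fun y : EuclideanSpace ℝ (Fin 2) => (1/2 : ℝ) * ∫ t in S..(‖y - x₀‖ ^ 2), g t) y (EuclideanSpace.single 0 (1:ℝ)) -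
      Gb y (EuclideanSpace.single 0 (1:ℝ)) *
      fderiv ℝ (fun y : EuclideanSpace ℝ (Fin 2) => (1/2 : ℝ) * ∫ t in S..(‖y - x₀‖ ^ 2), g t) y (EuclideanSpace.single 1 (1:ℝ)))) =
      fun y => g (‖y - x₀‖ ^ 2) * a y * Gb y (perp (y - x₀)) := by
    funext y
    rw [fderiv_radialTest_apply_single x₀ hg hgS y 0, fderiv_radialTest_apply_single x₀ hg hgS y 1, apply_perp_eq]
    ring
  have hJR : (fun y => (1/2 : ℝ) * (∫ t in S..(‖y - x₀‖ ^ 2), g t) * (Ga y (EuclideanSpace.single 1 (1:ℝ)) *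
      Gb y (EuclideanSpace.single 0 (1:ℝ)) - Ga y (EuclideanSpace.single 0 (1:ℝ)) * Gb y (EuclideanSpace.single 1 (1:ℝ)))) =
      fun y => -((1/2 : ℝ) * (∫ t in S..(‖y - x₀‖ ^ 2), g t) * (Ga y (EuclideanSpace.single 0 (1:ℝ)) *
      Gb y (EuclideanSpace.single 1 (1:ℝ)) - Ga y (EuclideanSpace.single 1 (1:ℝ)) * Gb y (EuclideanSpace.single 0 (1:ℝ)))) := by
    funext y; ring
  rw [hJL, hJR, integral_neg] at hJ
  -- assemble: `∫ 2(sg′+g)u = −∫ g·Gu(y−x₀) = 2∫ η det = −2∫ g a Gb[perp]`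
  have h2 : ∫ y, 2 * (‖y - x₀‖ ^ 2 * deriv g (‖y - x₀‖ ^ 2) + g (‖y - x₀‖ ^ 2)) * u y =
      2 * ∫ y, (‖y - x₀‖ ^ 2 * deriv g (‖y - x₀‖ ^ 2) + g (‖y - x₀‖ ^ 2)) * u y := by
    rw [← integral_const_mul]
    refine integral_congr_ae (Filter.Eventually.of_forall fun y => ?_)
    simp only
    ring
  rw [h2] at hA
  linarith [hA, hB, hJ]

/-- ★★ The master identity with the weight written as a derivative: `∫ (s·g(s))′(‖y − x₀‖²)·u(y) dy = −∫ g(s) a Gb[perp(y − x₀)] dy`.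
[cite: Helein2002, §3.1; BrezisCoron1985, Appendix Lemma A.1] -/
theorem integral_deriv_mul_eq
    (hu : HasWeakFDerivOn (⟨univ, isOpen_univ⟩ : Opens (EuclideanSpace ℝ (Fin 2))) volume u Gu)
    (ha : HasWeakFDerivOn (⟨univ, isOpen_univ⟩ : Opens (EuclideanSpace ℝ (Fin 2))) volume a Ga)
    (hb : HasWeakFDerivOn (⟨univ, isOpen_univ⟩ : Opens (EuclideanSpace ℝ (Fin 2))) volume b Gb)
    (ha2 : LocallyIntegrable (fun y => a y ^ 2) volume) (hb2 : LocallyIntegrable (fun y => b y ^ 2) volume)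
    (hGa2 : LocallyIntegrable (fun y => ‖Ga y‖ ^ 2) volume) (hGb2 : LocallyIntegrable (fun y => ‖Gb y‖ ^ 2) volume)
    (hEq : ∀ η : EuclideanSpace ℝ (Fin 2) → ℝ, ContDiff ℝ ∞ η → HasCompactSupport η →
      -(∫ y, ∑ k : Fin 2, fderiv ℝ η y (EuclideanSpace.single k (1:ℝ)) * Gu y (EuclideanSpace.single k (1:ℝ))) =
        2 * ∫ y, η y * (Ga y (EuclideanSpace.single 0 (1:ℝ)) * Gb y (EuclideanSpace.single 1 (1:ℝ)) -
          Ga y (EuclideanSpace.single 1 (1:ℝ)) * Gb y (EuclideanSpace.single 0 (1:ℝ))))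
    {g : ℝ → ℝ} (hg : ContDiff ℝ ∞ g) {S : ℝ} (hgS : ∀ s, S ≤ s → g s = 0) :
    ∫ y, deriv (fun s => s * g s) (‖y - x₀‖ ^ 2) * u y = -∫ y, g (‖y - x₀‖ ^ 2) * a y * Gb y (perp (y - x₀)) := by
  have hd : ∀ s, deriv (fun s => s * g s) s = s * deriv g s + g s := by
    intro s
    have h : HasDerivAt (fun s : ℝ => s * g s) (1 * g s + s * deriv g s) s :=
      (hasDerivAt_id' s).mul ((hg.differentiable (by simp)) s).hasDerivAt
    rw [h.deriv]
    ring
  simp_rw [hd]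
  exact integral_radialWeight_mul_eq x₀ hu ha hb ha2 hb2 hGa2 hGb2 hEq hg hgS

end Master

/-! ## §2 The annular kernels -/

/-- `h_r(s) := ST((4s∕r² − 1)∕3)` is smooth. [folklore] -/
theorem contDiff_annularProfile (r : ℝ) :
    ContDiff ℝ ∞ (fun s : ℝ => Real.smoothTransition ((4 * s / r ^ 2 - 1) / 3)) :=
  Real.smoothTransition.contDiff.comp (((contDiff_const.mul contDiff_id).div_const _ |>.sub contDiff_const).div_const _)

/-- `h_r(s) = 0` for `s ≤ r²∕4`. [folklore] -/
theorem annularProfile_eq_zero {r s : ℝ} (hr : 0 < r) (hs : s ≤ r ^ 2 / 4) :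
    Real.smoothTransition ((4 * s / r ^ 2 - 1) / 3) = 0 := by
  apply Real.smoothTransition.zero_of_nonpos
  have hr2 : 0 < r ^ 2 := by positivity
  have : 4 * s / r ^ 2 ≤ 1 := by rw [div_le_one hr2]; linarith
  linarith

/-- `h_r(s) = 1` for `r² ≤ s`. [folklore] -/
theorem annularProfile_eq_one {r s : ℝ} (hr : 0 < r) (hs : r ^ 2 ≤ s) :
    Real.smoothTransition ((4 * s / r ^ 2 - 1) / 3) = 1 := by
  apply Real.smoothTransition.one_of_one_le
  have hr2 : 0 < r ^ 2 := by positivity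
  have : 1 ≤ s / r ^ 2 := by rw [le_div_iff₀ hr2]; linarith
  have h4 : 4 * s / r ^ 2 = 4 * (s / r ^ 2) := by ring
  rw [h4]; linarith

/-- `0 ≤ h_r ≤ 1`. [folklore] -/
theorem annularProfile_mem_Icc (r s : ℝ) :
    0 ≤ Real.smoothTransition ((4 * s / r ^ 2 - 1) / 3) ∧ Real.smoothTransition ((4 * s / r ^ 2 - 1) / 3) ≤ 1 :=
  ⟨Real.smoothTransition.nonneg _, Real.smoothTransition.le_one _⟩

/-- `h_r′(s) = r⁻²·Ψ(s∕r²)`, `Ψ(t) = (4∕3)·ST′((4t − 1)∕3)`. [folklore] -/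
theorem hasDerivAt_annularProfile {r : ℝ} (hr : 0 < r) (s : ℝ) :
    HasDerivAt (fun s : ℝ => Real.smoothTransition ((4 * s / r ^ 2 - 1) / 3))
      ((r ^ 2)⁻¹ * ((4/3 : ℝ) * deriv Real.smoothTransition ((4 * (s / r ^ 2) - 1) / 3))) s := by
  have hr2 : r ^ 2 ≠ 0 := by positivity
  have hin : HasDerivAt (fun s : ℝ => (4 * s / r ^ 2 - 1) / 3) (4 * 1 / r ^ 2 / 3) s :=
    ((((hasDerivAt_id' s).const_mul (4:ℝ)).div_const (r ^ 2)).sub_const (1:ℝ)).div_const (3:ℝ)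
  have hST : HasDerivAt Real.smoothTransition (deriv Real.smoothTransition ((4 * s / r ^ 2 - 1) / 3)) ((4 * s / r ^ 2 - 1) / 3) :=
    ((Real.smoothTransition.contDiff (n := 1)).differentiable (by simp) _).hasDerivAt
  have h := hST.comp s hin
  have h2 : HasDerivAt (fun s : ℝ => Real.smoothTransition ((4 * s / r ^ 2 - 1) / 3))
      (deriv Real.smoothTransition ((4 * s / r ^ 2 - 1) / 3) * (4 * 1 / r ^ 2 / 3)) s := h
  refine h2.congr_deriv ?_
  rw [← mul_div_assoc]
  field_simp

/-- The kernel `Ψ(t) = (4∕3)·ST′((4t − 1)∕3)` is continuous and vanishes for `t ≤ 1∕4` and for `1 ≤ t`. [folklore] -/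
theorem annularKernel_props :
    Continuous (fun t : ℝ => (4/3 : ℝ) * deriv Real.smoothTransition ((4 * t - 1) / 3)) ∧
      ∀ t : ℝ, (t ≤ 1/4 ∨ 1 ≤ t) → (4/3 : ℝ) * deriv Real.smoothTransition ((4 * t - 1) / 3) = 0 := by
  have hc : Continuous (deriv Real.smoothTransition) := (Real.smoothTransition.contDiff (n := 1)).continuous_deriv (by simp)
  refine ⟨continuous_const.mul (hc.comp (by fun_prop)), fun t ht => ?_⟩
  rcases ht with ht | ht
  · -- `ST` vanishes identically on a neighbourhood of `(4t−1)/3 ≤ 0` only when `< 0`; at the boundary use the local minimum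
    have h0 : (4 * t - 1) / 3 ≤ 0 := by linarith
    have hmin : IsLocalMin Real.smoothTransition ((4 * t - 1) / 3) :=
      Filter.Eventually.of_forall fun z => by
        rw [Real.smoothTransition.zero_of_nonpos h0]; exact Real.smoothTransition.nonneg z
    rw [hmin.deriv_eq_zero, mul_zero]
  · have h1 : 1 ≤ (4 * t - 1) / 3 := by linarith
    have hmax : IsLocalMax Real.smoothTransition ((4 * t - 1) / 3) :=
      Filter.Eventually.of_forall fun z => by
        rw [Real.smoothTransition.one_of_one_le h1]; exact Real.smoothTransition.le_one z
    rw [hmax.deriv_eq_zero, mul_zero]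

/-- The difference profile `g(s) = (h_{r₀}(s) − h_{r₁}(s))∕s` is smooth (the numerator vanishes near `s ≤ 0`), vanishes on
`[max(r₀,r₁)², ∞)`, satisfies `s·g(s) = h_{r₀}(s) − h_{r₁}(s)` and `|g(s)|·s ≤ 1` for `s > 0`, and `g(s) = 0` for
`s ≤ min(r₀,r₁)²∕4`. [folklore] -/
theorem diffProfile_props {r₀ r₁ : ℝ} (hr₀ : 0 < r₀) (hr₁ : 0 < r₁) :
    ContDiff ℝ ∞ (fun s : ℝ => (Real.smoothTransition ((4 * s / r₀ ^ 2 - 1) / 3) -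
        Real.smoothTransition ((4 * s / r₁ ^ 2 - 1) / 3)) / s) ∧
    (∀ s : ℝ, max (r₀ ^ 2) (r₁ ^ 2) ≤ s → (Real.smoothTransition ((4 * s / r₀ ^ 2 - 1) / 3) -
        Real.smoothTransition ((4 * s / r₁ ^ 2 - 1) / 3)) / s = 0) ∧
    (∀ s : ℝ, s * ((Real.smoothTransition ((4 * s / r₀ ^ 2 - 1) / 3) -
        Real.smoothTransition ((4 * s / r₁ ^ 2 - 1) / 3)) / s) = Real.smoothTransition ((4 * s / r₀ ^ 2 - 1) / 3) -
        Real.smoothTransition ((4 * s / r₁ ^ 2 - 1) / 3)) ∧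
    (∀ s : ℝ, 0 < s → |(Real.smoothTransition ((4 * s / r₀ ^ 2 - 1) / 3) -
        Real.smoothTransition ((4 * s / r₁ ^ 2 - 1) / 3)) / s| * s ≤ 1) ∧
    (∀ s : ℝ, s ≤ min (r₀ ^ 2) (r₁ ^ 2) / 4 → (Real.smoothTransition ((4 * s / r₀ ^ 2 - 1) / 3) -
        Real.smoothTransition ((4 * s / r₁ ^ 2 - 1) / 3)) / s = 0) := by
  have hnum0 : ∀ s : ℝ, s ≤ min (r₀ ^ 2) (r₁ ^ 2) / 4 → Real.smoothTransition ((4 * s / r₀ ^ 2 - 1) / 3) -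
      Real.smoothTransition ((4 * s / r₁ ^ 2 - 1) / 3) = 0 := by
    intro s hs
    rw [annularProfile_eq_zero hr₀ (by linarith [min_le_left (r₀ ^ 2) (r₁ ^ 2)]),
      annularProfile_eq_zero hr₁ (by linarith [min_le_right (r₀ ^ 2) (r₁ ^ 2)]), sub_zero]
  have hm : 0 < min (r₀ ^ 2) (r₁ ^ 2) / 4 := by
    have : 0 < min (r₀ ^ 2) (r₁ ^ 2) := lt_min (by positivity) (by positivity)
    linarith
  refine ⟨?_, ?_, ?_, ?_, ?_⟩
  · -- smoothness: near `s ≤ 0` the function vanishes identically; for `s > 0` it is a quotient of smooth functions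
    have hN : ContDiff ℝ ∞ (fun s : ℝ => Real.smoothTransition ((4 * s / r₀ ^ 2 - 1) / 3) -
        Real.smoothTransition ((4 * s / r₁ ^ 2 - 1) / 3)) := (contDiff_annularProfile r₀).sub (contDiff_annularProfile r₁)
    refine contDiff_iff_contDiffAt.2 fun s => ?_
    by_cases hs : s < min (r₀ ^ 2) (r₁ ^ 2) / 4
    · have hev : (fun s : ℝ => (Real.smoothTransition ((4 * s / r₀ ^ 2 - 1) / 3) -
          Real.smoothTransition ((4 * s / r₁ ^ 2 - 1) / 3)) / s) =ᶠ[𝓝 s] fun _ => 0 := by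
        filter_upwards [Iio_mem_nhds hs] with z hz
        rw [hnum0 z hz.le, zero_div]
      exact (contDiffAt_const (c := (0:ℝ))).congr_of_eventuallyEq hev
    · have hs0 : s ≠ 0 := (hm.trans_le (not_lt.1 hs)).ne'
      exact hN.contDiffAt.div contDiffAt_id hs0
  · intro s hs
    rw [annularProfile_eq_one hr₀ ((le_max_left _ _).trans hs), annularProfile_eq_one hr₁ ((le_max_right _ _).trans hs),
      sub_self, zero_div]
  · intro s
    by_cases hs : s = 0
    · subst hs
      rw [hnum0 0 hm.le]; simp
    · field_simp
  · intro s hs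
    rw [abs_div, abs_of_pos hs, div_mul_cancel₀ _ hs.ne']
    obtain ⟨h0a, h0b⟩ := annularProfile_mem_Icc r₀ s
    obtain ⟨h1a, h1b⟩ := annularProfile_mem_Icc r₁ s
    rw [abs_le]; constructor <;> linarith
  · intro s hs
    rw [hnum0 s hs, zero_div]

/-! ## §3 The annular identity -/

/-- ★★★ **THE ANNULAR IDENTITY (one centre, every pair of radii).**  In the setting of `integral_radialWeight_mul_eq`, for all
`r₀, r₁ > 0` the smooth annular averages `𝒜_r u x₀ = (π r²)⁻¹ ∫ Ψ(‖y − x₀‖²∕r²)·u(y) dy` (`Ψ(t) = (4∕3)·ST′((4t−1)∕3)`) satisfy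
`𝒜_{r₀} u x₀ − 𝒜_{r₁} u x₀ = −π⁻¹ ∫ g(‖y − x₀‖²)·a(y)·Gb y (perp (y − x₀)) dy` with `g = (h_{r₀} − h_{r₁})∕s`.
[cite: Helein2002, §3.1 (Wente's lemma by polar coordinates); Topping1997, Theorem (sharp one-centre form)] -/
theorem annularAverage_sub_eq (x₀ : EuclideanSpace ℝ (Fin 2)) {u a b : EuclideanSpace ℝ (Fin 2) → ℝ}
    {Gu Ga Gb : EuclideanSpace ℝ (Fin 2) → EuclideanSpace ℝ (Fin 2) →L[ℝ] ℝ}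
    (hu : HasWeakFDerivOn (⟨univ, isOpen_univ⟩ : Opens (EuclideanSpace ℝ (Fin 2))) volume u Gu)
    (ha : HasWeakFDerivOn (⟨univ, isOpen_univ⟩ : Opens (EuclideanSpace ℝ (Fin 2))) volume a Ga)
    (hb : HasWeakFDerivOn (⟨univ, isOpen_univ⟩ : Opens (EuclideanSpace ℝ (Fin 2))) volume b Gb)
    (ha2 : LocallyIntegrable (fun y => a y ^ 2) volume) (hb2 : LocallyIntegrable (fun y => b y ^ 2) volume)
    (hGa2 : LocallyIntegrable (fun y => ‖Ga y‖ ^ 2) volume) (hGb2 : LocallyIntegrable (fun y => ‖Gb y‖ ^ 2) volume)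
    (hEq : ∀ η : EuclideanSpace ℝ (Fin 2) → ℝ, ContDiff ℝ ∞ η → HasCompactSupport η →
      -(∫ y, ∑ k : Fin 2, fderiv ℝ η y (EuclideanSpace.single k (1:ℝ)) * Gu y (EuclideanSpace.single k (1:ℝ))) =
        2 * ∫ y, η y * (Ga y (EuclideanSpace.single 0 (1:ℝ)) * Gb y (EuclideanSpace.single 1 (1:ℝ)) -
          Ga y (EuclideanSpace.single 1 (1:ℝ)) * Gb y (EuclideanSpace.single 0 (1:ℝ))))
    {r₀ r₁ : ℝ} (hr₀ : 0 < r₀) (hr₁ : 0 < r₁) :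
    (Real.pi * r₀ ^ 2)⁻¹ * (∫ y, (4/3 : ℝ) * deriv Real.smoothTransition ((4 * (‖y - x₀‖ ^ 2 / r₀ ^ 2) - 1) / 3) * u y) -
      (Real.pi * r₁ ^ 2)⁻¹ * (∫ y, (4/3 : ℝ) * deriv Real.smoothTransition ((4 * (‖y - x₀‖ ^ 2 / r₁ ^ 2) - 1) / 3) * u y) =
      -(Real.pi)⁻¹ * ∫ y, (Real.smoothTransition ((4 * ‖y - x₀‖ ^ 2 / r₀ ^ 2 - 1) / 3) -
        Real.smoothTransition ((4 * ‖y - x₀‖ ^ 2 / r₁ ^ 2 - 1) / 3)) / ‖y - x₀‖ ^ 2 * a y * Gb y (perp (y - x₀)) := by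
  obtain ⟨hgs, hgS, hsg, -, -⟩ := diffProfile_props hr₀ hr₁
  have hmain := integral_deriv_mul_eq x₀ hu ha hb ha2 hb2 hGa2 hGb2 hEq hgs hgS
  -- the weight `(s·g(s))′ = h_{r₀}′ − h_{r₁}′`
  have hw : ∀ s : ℝ, deriv (fun s => s * ((Real.smoothTransition ((4 * s / r₀ ^ 2 - 1) / 3) -
      Real.smoothTransition ((4 * s / r₁ ^ 2 - 1) / 3)) / s)) s =
      (r₀ ^ 2)⁻¹ * ((4/3 : ℝ) * deriv Real.smoothTransition ((4 * (s / r₀ ^ 2) - 1) / 3)) -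
      (r₁ ^ 2)⁻¹ * ((4/3 : ℝ) * deriv Real.smoothTransition ((4 * (s / r₁ ^ 2) - 1) / 3)) := by
    intro s
    have hfun : (fun s => s * ((Real.smoothTransition ((4 * s / r₀ ^ 2 - 1) / 3) -
        Real.smoothTransition ((4 * s / r₁ ^ 2 - 1) / 3)) / s)) = fun s => Real.smoothTransition ((4 * s / r₀ ^ 2 - 1) / 3) -
        Real.smoothTransition ((4 * s / r₁ ^ 2 - 1) / 3) := funext hsg
    rw [hfun]
    exact ((hasDerivAt_annularProfile hr₀ s).sub (hasDerivAt_annularProfile hr₁ s)).deriv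
  simp_rw [hw] at hmain
  -- integrability of the two kernel terms against `u`
  have hul : LocallyIntegrable u volume := by
    have := hu.locallyIntegrableOn; simpa [locallyIntegrableOn_univ] using this
  obtain ⟨hΨc, hΨ0⟩ := annularKernel_props
  have hint : ∀ {r : ℝ}, 0 < r → Integrable (fun y => (r ^ 2)⁻¹ * ((4/3 : ℝ) *
      deriv Real.smoothTransition ((4 * (‖y - x₀‖ ^ 2 / r ^ 2) - 1) / 3)) * u y) volume := by
    intro r hr
    have hc : Continuous fun y : EuclideanSpace ℝ (Fin 2) => (r ^ 2)⁻¹ * ((4/3 : ℝ) *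
        deriv Real.smoothTransition ((4 * (‖y - x₀‖ ^ 2 / r ^ 2) - 1) / 3)) :=
      continuous_const.mul (hΨc.comp (((continuous_id.sub continuous_const).norm.pow 2).div_const _))
    have hcs : HasCompactSupport fun y : EuclideanSpace ℝ (Fin 2) => (r ^ 2)⁻¹ * ((4/3 : ℝ) *
        deriv Real.smoothTransition ((4 * (‖y - x₀‖ ^ 2 / r ^ 2) - 1) / 3)) := by
      apply HasCompactSupport.intro (isCompact_closedBall x₀ r)
      intro y hy
      rw [mem_closedBall, dist_eq_norm, not_le] at hy
      have h1 : 1 ≤ ‖y - x₀‖ ^ 2 / r ^ 2 := by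
        rw [le_div_iff₀ (by positivity), one_mul]
        exact pow_le_pow_left₀ hr.le hy.le 2
      rw [hΨ0 _ (Or.inr h1), mul_zero]
    simpa [smul_eq_mul] using hul.integrable_smul_left_of_hasCompactSupport hc hcs
  have hsplit : ∫ y, ((r₀ ^ 2)⁻¹ * ((4/3 : ℝ) * deriv Real.smoothTransition ((4 * (‖y - x₀‖ ^ 2 / r₀ ^ 2) - 1) / 3)) -
      (r₁ ^ 2)⁻¹ * ((4/3 : ℝ) * deriv Real.smoothTransition ((4 * (‖y - x₀‖ ^ 2 / r₁ ^ 2) - 1) / 3))) * u y =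
      (r₀ ^ 2)⁻¹ * (∫ y, (4/3 : ℝ) * deriv Real.smoothTransition ((4 * (‖y - x₀‖ ^ 2 / r₀ ^ 2) - 1) / 3) * u y) -
      (r₁ ^ 2)⁻¹ * (∫ y, (4/3 : ℝ) * deriv Real.smoothTransition ((4 * (‖y - x₀‖ ^ 2 / r₁ ^ 2) - 1) / 3) * u y) := by
    rw [← integral_const_mul, ← integral_const_mul, ← integral_sub]
    · refine integral_congr_ae (Filter.Eventually.of_forall fun y => ?_); simp only; ring
    · exact (hint hr₀).congr (Filter.Eventually.of_forall fun y => by simp only; ring)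
    · exact (hint hr₁).congr (Filter.Eventually.of_forall fun y => by simp only; ring)
  rw [hsplit] at hmain
  have hπ : Real.pi ≠ 0 := Real.pi_ne_zero
  have hr₀2 : r₀ ^ 2 ≠ 0 := by positivity
  have hr₁2 : r₁ ^ 2 ≠ 0 := by positivity
  rw [mul_inv, mul_inv, mul_assoc, mul_assoc, ← mul_sub, hmain]
  ring

end Summit.QuantumFields.YangMills.Theorems.PoincareLipschitzWenteOneCentreIdentity

end
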